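import Summits.ValiantsHypothesis.ValiantsHypothesis.Theorems.BarrierLeverPartitionMinorsHitByVPHiddenStatesBallCutThirdShellReductionLe
import Summits.ValiantsHypothesis.ValiantsHypothesis.Theorems.BarrierLeverPartitionMinorsHitByVPHiddenStatesThirdShellLevelsLeTwoSeg0
import Summits.ValiantsHypothesis.ValiantsHypothesis.Theorems.BarrierLeverPartitionMinorsHitByVPHiddenStatesThirdShellLevelsLeTwoSeg1
import Summits.ValiantsHypothesis.ValiantsHypothesis.Theorems.BarrierLeverPartitionMinorsHitByVPHiddenStatesThirdShellLevelsLeTwoSeg2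
import Summits.ValiantsHypothesis.ValiantsHypothesis.Theorems.BarrierLeverPartitionMinorsHitByVPHiddenStatesThirdShellLevelsLeTwoSeg3
import Summits.ValiantsHypothesis.ValiantsHypothesis.Theorems.BarrierLeverPartitionMinorsHitByVPHiddenStatesThirdShellLevelsLeTwoSeg4
import Summits.ValiantsHypothesis.ValiantsHypothesis.Theorems.BarrierLeverPartitionMinorsHitByVPHiddenStatesThirdShellLevelsLeTwoSeg5
import Summits.ValiantsHypothesis.ValiantsHypothesis.Theorems.BarrierLeverPartitionMinorsHitByVPHiddenStatesThirdShellLevelsLeTwoSeg6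
import Summits.ValiantsHypothesis.ValiantsHypothesis.Theorems.BarrierLeverPartitionMinorsHitByVPHiddenStatesThirdShellLevelsLeTwoSeg7

/-!
# Route BarrierLever — item `PartitionMinorsHitByVP` (stmt-ValiantsHypothesis-19717), line `hidden-states`:
# ★★★ THE THIRD SHELL AT EVERY LEVEL t ≤ 2, FOR EVERY h — every 3-swap family `B_t(h) ∖ {A_l} ∪ {C_l}` (t ≤ 2, down-closed) is served

Helper file (`--supports stmt-ValiantsHypothesis-19717`, `--computational`; cell valiant-natproofs, 𝒟-side door (c), registered line
`Cruxes/PartitionMinorsHitByVP/Lines/hidden_states.lean` v10; prover seat val-np-p6 gen 22; planner SUCCESSOR MANDATE STATUS l.1830 (P2)).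
Closes NO item (the column is support for 19717).

THE THEOREM.  ★★★ `exists_table_threeSwap_le_two`: for all `h`, all `t ≤ 2`, all injective `A : Fin 3 → t-sets`, `C : Fin 3 → (t+1)-sets` of
`Fin h` with no `A_l ⊆ C_l'`, every standard-form configuration of the family `B_t(h) ∖ {A_l} ∪ {C_l}` against the ball `B_t(h)` has a
table with nonzero determinant.  ASSEMBLY: the level-bounded reduction `exists_table_threeSwap_of_unbalanced_le 2` (`…ReductionLe`, after
val-np-p6 g21's `…ThirdShellReduction`) needs every TOTALLY UNBALANCED 3-swap family of level `t ≤ 2` served on its support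
(`served_unbalanced_le_two`): `t = 0` is vacuous (two empty `A`'s), and for `t = 1, 2` the CLASSIFICATION ENGINE (`…BallCutClassification`,
`…ClassificationCheck`) reduces «every family» to ONE Boolean per level: `checkAll unbalancedTypes t …` — every run-length coordinate-type list
with the level's incidence budgets (a COMPLETE enumeration, `rlList_mem_enumSeq`) whose rebuilt family is a down-closed 3-swap family passes the
fast packed-LU certificate of `…BallCutCertKitFast` (val-np-p4 g30's verified checkers) — `checkAll_one` (542 lists, one `native_decide`),
`checkAll_two` (28 971 lists, eight segment files `…LevelsLeTwoSeg0…7` + `checkAll_of_seg`).  No isomorphism test, no symmetry reduction.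

RANGE / HONEST LABEL: computational lane (`Lean.ofReduceBool`: the segment checks, `checkAll_one`, the enumeration length); kernel otherwise.
This is the column's conjecture S₃ («the third shell») at the levels `t ≤ 2`, all `h`; levels `t ≥ 3` remain (t = 3: all 61 cores + supports
6–10 of the chart are theorems, the rest lab-certified; conjectures `Stmt.conjJD` / `Stmt.conjJDPlus`).  19717 stays OPEN; nothing on crux
14610 or VP ≠ VNP.
-/

set_option linter.dupNamespace false

namespace Summit.ValiantsHypothesis.ValiantsHypothesis.Theorems.BarrierLever.HiddenStates

open Finset

noncomputable section

namespace BallCut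

open MoorePeel

/-- **Level 1: the whole classification check** (542 type lists; computational). -/
theorem checkAll_one : checkAll unbalancedTypes 1 [7, 11, 13] 65521 = true := by
  native_decide

/-- The level-2 enumeration has at most `8 · 3650` entries (it has 28 971; computational). -/
theorem length_enumSeq_two_le : (enumSeq unbalancedTypes (budget 2)).length ≤ 8 * 3650 := by
  native_decide

/-- **Level 2: the whole classification check**, from the eight segments. -/
theorem checkAll_two : checkAll unbalancedTypes 2 [7, 11, 13] 65521 = true := by
  refine checkAll_of_seg unbalancedTypes 2 [7, 11, 13] 65521 3650 8 length_enumSeq_two_le fun i hi => ?_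
  interval_cases i
  · exact checkAllSeg_two_0
  · exact checkAllSeg_two_1
  · exact checkAllSeg_two_2
  · exact checkAllSeg_two_3
  · exact checkAllSeg_two_4
  · exact checkAllSeg_two_5
  · exact checkAllSeg_two_6
  · exact checkAllSeg_two_7

/-- ★★ **Every totally unbalanced 3-swap family of level `t ≤ 2` is served on its support** (the hypothesis of the level-bounded reduction). -/
theorem served_unbalanced_le_two (n t : ℕ) (A C : Fin 3 → Finset (Fin n)) (ht : t ≤ 2)
    (hA : ∀ l, (A l).card = t) (hC : ∀ l, (C l).card = t + 1)
    (hAi : Function.Injective A) (hCi : Function.Injective C) (hAC : ∀ l l', ¬ A l ⊆ C l')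
    (htu : ∀ x : Fin n, (Finset.univ.filter fun l => x ∈ A l).card ≠ (Finset.univ.filter fun l => x ∈ C l).card)
    {r : ℕ} (u cols : Fin r → Finset (Fin n)) (hu : Function.Injective u)
    (hU : ∀ i, ((u i).card ≤ t ∧ ∀ l, u i ≠ A l) ∨ ∃ l, u i = C l)
    (hcols : ∀ J : Finset (Fin n), J.card ≤ t → ∃ kk, cols kk = J) :
    ∃ tx : Option (Fin n) → Fin n → ℂ,
      (Matrix.of fun i kk : Fin r => ∏ a ∈ u i, (tx none a + ∑ q ∈ cols kk, tx (some q) a)).det ≠ 0 := by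
  classical
  have hall : ∀ x, typeCode A C x ∈ unbalancedTypes := typeCode_mem_unbalancedTypes A C htu
  have hn : n ≤ 15 := by
    have := le_of_typeCode_mem_unbalancedTypes A C hall
    simp only [hA, hC, Finset.sum_const, Finset.card_univ, Fintype.card_fin, smul_eq_mul] at this
    omega
  have hB : 2 ^ n * (65521 * 65521) < packBase := by
    calc 2 ^ n * (65521 * 65521) ≤ 2 ^ 15 * (65521 * 65521) := Nat.mul_le_mul_right _ (Nat.pow_le_pow_right (by norm_num) hn)
      _ < packBase := by norm_num [packBase]
  interval_cases t
  · exfalso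
    have h0 : A 0 = ∅ := Finset.card_eq_zero.mp (hA 0)
    have h1 : A 1 = ∅ := Finset.card_eq_zero.mp (hA 1)
    exact absurd (hAi (h0.trans h1.symm)) (by decide)
  · exact exists_table_of_checkCnt unbalancedTypes nodup_unbalancedTypes bitSum_pos_of_mem_unbalancedTypes 1 n [7, 11, 13] prime_65521 hB
      (checkCnt_of_checkAll _ _ _ _ checkAll_one n) A C hall hA hC hAi hCi hAC u cols hu hU hcols
  · exact exists_table_of_checkCnt unbalancedTypes nodup_unbalancedTypes bitSum_pos_of_mem_unbalancedTypes 2 n [7, 11, 13] prime_65521 hB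
      (checkCnt_of_checkAll _ _ _ _ checkAll_two n) A C hall hA hC hAi hCi hAC u cols hu hU hcols

/-- ★★★ **THE THIRD SHELL IS SERVED AT EVERY LEVEL `t ≤ 2`, FOR EVERY `h`.** -/
theorem exists_table_threeSwap_le_two (h t : ℕ) (ht : t ≤ 2) (A C : Fin 3 → Finset (Fin h))
    (hA : ∀ l, (A l).card = t) (hC : ∀ l, (C l).card = t + 1)
    (hAi : Function.Injective A) (hCi : Function.Injective C) (hAC : ∀ l l', ¬ A l ⊆ C l')
    {r : ℕ} (u cols : Fin r → Finset (Fin h)) (hu : Function.Injective u)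
    (hU : ∀ i, ((u i).card ≤ t ∧ ∀ l, u i ≠ A l) ∨ ∃ l, u i = C l)
    (hcols : ∀ J : Finset (Fin h), J.card ≤ t → ∃ kk, cols kk = J) :
    ∃ tx : Option (Fin h) → Fin h → ℂ,
      (Matrix.of fun i kk : Fin r => ∏ a ∈ u i, (tx none a + ∑ q ∈ cols kk, tx (some q) a)).det ≠ 0 :=
  exists_table_threeSwap_of_unbalanced_le 2
    (fun n t A C ht hA hC hAi hCi hAC htu _ u cols hu hU hcols =>
      served_unbalanced_le_two n t A C ht hA hC hAi hCi hAC htu u cols hu hU hcols)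
    h t ht A C hA hC hAi hCi hAC u cols hu hU hcols

end BallCut

end

end Summit.ValiantsHypothesis.ValiantsHypothesis.Theorems.BarrierLever.HiddenStates
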